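import Mathlib
import Summits.MatrixMultiplication.MatrixMultiplication.Theorems.SoloBlindCorankOne
import Summits.MatrixMultiplication.MatrixMultiplication.Theorems.SoloBlindZModBasis
import Summits.MatrixMultiplication.MatrixMultiplication.Theorems.SoloBlindFlatExtremal

/-!
# Conjecture K♭ — statement, the core, corank zero, and sharpness on every layer

Sub-programme (K₃) (K3.39).  For `h : ι → G` (a `ZMod 3`-module), an index set `S` and a target `τ`, the CORE `C(τ; S)` is the
union of all representations `T ⊆ S`, `∑_T h = τ`; its size is `c` and its RANK `ρ = dim span h(C)`.  CONJECTURE K♭: if `h` is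
zero-sum free on `S` then

  `K(τ; S) ≤ 1 + 2^{-ρ} - 2^{ρ-c}`      (`soloBlindFlatBound ρ c`, `soloBlindKFlatAt h S τ`).

Since `c ≤ 2ρ` (Olson applied to the zero-sum-free core) the right side is `≤ 1`, so K♭ refines (K₃) (`K ≤ 1`) and Conjecture TOP
(`K = 1` only on the top layer `c = 2ρ`); it was found by exact computation (all zero-sum-free sequences of rank `≤ 5`; the type
model at corank `≤ 4`) and is attained on every layer.  This file records:

* `soloBlindCore`, `soloBlindCoreRank`, `soloBlindFlatBound`, `soloBlindKFlatAt` — the objects and the statement;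
* `soloBlind_core_subset`, `soloBlind_repAll_core`, `soloBlind_mass_core` — the core carries all the mass: `K(τ; S) = K(τ; C(τ; S))`;
  `soloBlind_coreRank_le_card` — `ρ ≤ c`; `soloBlind_flatBound_nonneg`;
* `soloBlind_kflat_sumDistinct` — K♭ AT CORANK ZERO (subset-sum-distinct `S`, e.g. a basis), with equality when `τ` is represented;
* `soloBlind_core_fx`, `soloBlind_coreRank_fx`, `soloBlind_kflat_sharp` — for the chain families `S(ρ, i₀)` of `SoloBlindFlatExtremal` the
  core is all of `S(ρ, i₀)`, its rank is `ρ`, its size `2ρ - i₀`, and `K ≥ soloBlindFlatBound ρ (2ρ - i₀)`: the conjectured bound cannot be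
  lowered on any layer `ρ ≤ c ≤ 2ρ`.
-/

namespace Summit.MatrixMultiplication.MatrixMultiplication.Theorems

open Finset

universe u

variable {ι : Type*} [DecidableEq ι]
variable {G : Type u} [AddCommGroup G] [DecidableEq G]

/-- The CORE of the target `τ` on `S`: the union of all representations of `τ`. -/
def soloBlindCore (h : ι → G) (S : Finset ι) (τ : G) : Finset ι :=
  (soloBlindSeqRepAll h S τ).biUnion id

/-- The RANK of the core: the dimension of the span of its values. -/
noncomputable def soloBlindCoreRank [Module (ZMod 3) G] (h : ι → G) (S : Finset ι) (τ : G) : ℕ :=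
  Module.finrank (ZMod 3) (Submodule.span (ZMod 3) (h '' (↑(soloBlindCore h S τ) : Set ι)))

/-- The conjectured bound `1 + 2^{-ρ} - 2^{ρ - c}` as a function of the core rank `ρ` and core size `c ≥ ρ`. -/
def soloBlindFlatBound (ρ c : ℕ) : ℚ := 1 + (1 / 2 : ℚ) ^ ρ - (1 / 2 : ℚ) ^ (c - ρ)

/-- CONJECTURE K♭ at `(h, S, τ)`: `K(τ; S) ≤ 1 + 2^{-ρ} - 2^{ρ - c}` for the core rank `ρ` and core size `c`.  (Conjectured for
every `h` zero-sum free on `S` in a `ZMod 3`-module; open.) -/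
def soloBlindKFlatAt [Module (ZMod 3) G] (h : ι → G) (S : Finset ι) (τ : G) : Prop :=
  soloBlindMass h S τ ≤ soloBlindFlatBound (soloBlindCoreRank h S τ) (soloBlindCore h S τ).card

/-- Membership in the core. -/
theorem soloBlind_mem_core {h : ι → G} {S : Finset ι} {τ : G} {x : ι} :
    x ∈ soloBlindCore h S τ ↔ ∃ T ∈ soloBlindSeqRepAll h S τ, x ∈ T := by
  simp [soloBlindCore]

/-- The core lies inside `S`. -/
theorem soloBlind_core_subset (h : ι → G) (S : Finset ι) (τ : G) : soloBlindCore h S τ ⊆ S := by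
  intro x hx
  obtain ⟨T, hT, hxT⟩ := soloBlind_mem_core.1 hx
  exact (soloBlind_mem_seqRepAll.1 hT).1 hxT

/-- The representations of `τ` inside the core are exactly the representations of `τ` inside `S`. -/
theorem soloBlind_repAll_core (h : ι → G) (S : Finset ι) (τ : G) :
    soloBlindSeqRepAll h (soloBlindCore h S τ) τ = soloBlindSeqRepAll h S τ := by
  ext T
  rw [soloBlind_mem_seqRepAll, soloBlind_mem_seqRepAll]
  constructor
  · rintro ⟨hT, hs⟩
    exact ⟨hT.trans (soloBlind_core_subset h S τ), hs⟩
  · rintro ⟨hT, hs⟩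
    exact ⟨fun x hx => soloBlind_mem_core.2 ⟨T, soloBlind_mem_seqRepAll.2 ⟨hT, hs⟩, hx⟩, hs⟩

/-- The core carries all the mass: `K(τ; C(τ; S)) = K(τ; S)`. -/
theorem soloBlind_mass_core (h : ι → G) (S : Finset ι) (τ : G) :
    soloBlindMass h (soloBlindCore h S τ) τ = soloBlindMass h S τ := by
  rw [soloBlindMass, soloBlindMass, soloBlind_repAll_core]

/-- `ρ ≤ c`: the rank of the core is at most its size. -/
theorem soloBlind_coreRank_le_card [Module (ZMod 3) G] (h : ι → G) (S : Finset ι) (τ : G) :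
    soloBlindCoreRank h S τ ≤ (soloBlindCore h S τ).card := by
  unfold soloBlindCoreRank
  rw [← Finset.coe_image]
  exact (finrank_span_finset_le_card _).trans Finset.card_image_le

/-- The bound is non-negative. -/
theorem soloBlind_flatBound_nonneg (ρ c : ℕ) : 0 ≤ soloBlindFlatBound ρ c := by
  unfold soloBlindFlatBound
  have h1 : (1 / 2 : ℚ) ^ (c - ρ) ≤ 1 := pow_le_one₀ (by norm_num) (by norm_num)
  have h2 : 0 ≤ (1 / 2 : ℚ) ^ ρ := by positivity
  linarith

/-- The bound is at most `1` when `c ≤ 2ρ` (which Olson's bound guarantees for a zero-sum-free core). -/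
theorem soloBlind_flatBound_le_one {ρ c : ℕ} (hc : c ≤ 2 * ρ) : soloBlindFlatBound ρ c ≤ 1 := by
  unfold soloBlindFlatBound
  have h1 : (1 / 2 : ℚ) ^ ρ ≤ (1 / 2 : ℚ) ^ (c - ρ) :=
    pow_le_pow_of_le_one (by norm_num) (by norm_num) (by omega)
  linarith

/-! ## Corank zero -/

/-- With at most one representation the core is that representation (or empty). -/
theorem soloBlind_core_of_card_le_one {h : ι → G} {S : Finset ι} {τ : G}
    (hR : (soloBlindSeqRepAll h S τ).card ≤ 1) {T : Finset ι} (hT : T ∈ soloBlindSeqRepAll h S τ) :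
    soloBlindCore h S τ = T := by
  have hRT : soloBlindSeqRepAll h S τ = {T} :=
    Finset.eq_singleton_iff_unique_mem.2 ⟨hT, fun T' hT' => Finset.card_le_one.1 hR T' hT' T hT⟩
  rw [soloBlindCore, hRT, Finset.singleton_biUnion, id]

/-- K♭ AT CORANK ZERO: if `S` is subset-sum distinct for `h` (e.g. `h` maps `S` injectively onto a linearly independent set), then
`K(τ; S) ≤ 1 + 2^{-ρ} - 2^{ρ - c}` — indeed `τ` has at most one representation `T`, the core is `T`, `ρ = c = |T|` and both sides
equal `2^{-|T|}` (or `K = 0`). -/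
theorem soloBlind_kflat_sumDistinct [Module (ZMod 3) G] {h : ι → G} {S : Finset ι}
    (hdist : ∀ A ⊆ S, ∀ A' ⊆ S, ∑ i ∈ A, h i = ∑ i ∈ A', h i → A = A') (τ : G) :
    soloBlindKFlatAt h S τ := by
  classical
  unfold soloBlindKFlatAt
  have hR := soloBlind_repAll_card_le_one_of_sumDistinct hdist τ
  by_cases hempty : soloBlindSeqRepAll h S τ = ∅
  · have h0 : soloBlindMass h S τ = 0 := by rw [soloBlindMass, hempty, Finset.sum_empty]
    rw [h0]
    exact soloBlind_flatBound_nonneg _ _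
  · obtain ⟨T, hT⟩ := Finset.nonempty_iff_ne_empty.2 hempty
    have hcore := soloBlind_core_of_card_le_one hR hT
    have hTS : T ⊆ S := (soloBlind_mem_seqRepAll.1 hT).1
    -- the rank of the core `T` is `|T|`
    have hli : LinearIndependent (ZMod 3) (fun i : T => h i) :=
      soloBlind_linearIndependent_of_subsetSum_inj h T
        (fun A hA A' hA' hs => hdist A (hA.trans hTS) A' (hA'.trans hTS) hs)
    have hrank : soloBlindCoreRank h S τ = T.card := by
      unfold soloBlindCoreRank
      rw [hcore, show h '' (↑T : Set ι) = Set.range (fun i : T => h i) by ext; simp, finrank_span_eq_card hli,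
        Fintype.card_coe]
    have hmass : soloBlindMass h S τ ≤ (1 / 2 : ℚ) ^ T.card :=
      soloBlind_mass_le_pow_of_card_le_one h S τ T.card hR
        (fun T' hT' => by rw [Finset.card_le_one.1 hR T' hT' T hT])
    rw [hrank, hcore]
    unfold soloBlindFlatBound
    rw [Nat.sub_self, pow_zero]
    linarith

/-! ## Sharpness on every layer -/

/-- The core of the all-ones target on the chain family `S(ρ, i₀)` is all of `S(ρ, i₀)`. -/
theorem soloBlind_core_fx (ρ i₀ : ℕ) :
    soloBlindCore (soloBlindFxH ρ) (soloBlindFxS ρ i₀) (soloBlindFxTau ρ) = soloBlindFxS ρ i₀ := by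
  refine Finset.Subset.antisymm (soloBlind_core_subset _ _ _) (fun x hx => ?_)
  obtain ⟨T, hT, hxT⟩ := soloBlindFx_core x hx
  exact soloBlind_mem_core.2 ⟨T, hT, hxT⟩

/-- `e_k` is the `k`-th standard basis vector. -/
theorem soloBlindFxH_false_eq_single {ρ : ℕ} (k : Fin ρ) :
    soloBlindFxH ρ (false, (k : ℕ)) = Pi.single k 1 := by
  funext k'
  simp only [soloBlindFxH, Pi.single_apply]
  by_cases hk : k' = k
  · rw [if_pos (by rw [hk]), if_pos hk]
  · rw [if_neg (fun e => hk (Fin.ext e)), if_neg hk]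

/-- The values of the chain family on `S(ρ, i₀)` span `Fin ρ → ZMod 3`. -/
theorem soloBlind_span_fx (ρ i₀ : ℕ) :
    Submodule.span (ZMod 3) (soloBlindFxH ρ '' (↑(soloBlindFxS ρ i₀) : Set (Bool × ℕ))) = ⊤ := by
  apply top_unique
  rw [← (Pi.basisFun (ZMod 3) (Fin ρ)).span_eq]
  apply Submodule.span_mono
  rintro v ⟨k, rfl⟩
  refine ⟨(false, (k : ℕ)), ?_, ?_⟩
  · rw [Finset.mem_coe]
    unfold soloBlindFxS
    exact Finset.mem_union_left _ (Finset.mem_image_of_mem _ (Finset.mem_range.2 k.isLt))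
  · rw [Pi.basisFun_apply]
    exact soloBlindFxH_false_eq_single k

/-- The core rank of the chain family is `ρ`. -/
theorem soloBlind_coreRank_fx (ρ i₀ : ℕ) :
    soloBlindCoreRank (soloBlindFxH ρ) (soloBlindFxS ρ i₀) (soloBlindFxTau ρ) = ρ := by
  unfold soloBlindCoreRank
  rw [soloBlind_core_fx, soloBlind_span_fx, finrank_top, Module.finrank_fin_fun]

/-- SHARPNESS OF K♭ ON EVERY LAYER: for the chain family `S(ρ, i₀)` (`i₀ ≤ ρ`; core rank `ρ`, core size `c = 2ρ - i₀`) the mass of the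
all-ones target is at least the conjectured bound `soloBlindFlatBound ρ c = 1 + 2^{-ρ} - 2^{ρ - c}`. -/
theorem soloBlind_kflat_sharp {ρ i₀ : ℕ} (hi : i₀ ≤ ρ) :
    soloBlindFlatBound (soloBlindCoreRank (soloBlindFxH ρ) (soloBlindFxS ρ i₀) (soloBlindFxTau ρ))
        (soloBlindCore (soloBlindFxH ρ) (soloBlindFxS ρ i₀) (soloBlindFxTau ρ)).card
      ≤ soloBlindMass (soloBlindFxH ρ) (soloBlindFxS ρ i₀) (soloBlindFxTau ρ) := by
  rw [soloBlind_coreRank_fx, soloBlind_core_fx, soloBlindFx_card]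
  unfold soloBlindFlatBound
  rw [show ρ + (ρ - i₀) - ρ = ρ - i₀ by omega]
  exact soloBlindFx_mass_ge hi

end Summit.MatrixMultiplication.MatrixMultiplication.Theorems
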